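import Summits.Ventures.PercRepro.GenQLargeEightNumA
import Summits.Ventures.PercRepro.GenQLargeEightNumB
import Summits.Ventures.PercRepro.GenQLargeEightNumC
import Summits.Ventures.PercRepro.GenQLargeEightNumD
import Summits.Ventures.PercRepro.GenQLargeEightNumE
import Summits.Ventures.PercRepro.GenQLargeEightNumF
import Summits.Ventures.PercRepro.GenQLargeEightNumG
import Summits.Ventures.PercRepro.GenQLargeEightNumH
import Summits.Ventures.PercRepro.GenQLargeEightNumI
import Summits.Ventures.PercRepro.GenQLargeEightNumJ
import Summits.Ventures.PercRepro.GenQLargeEightNumK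
import Summits.Ventures.PercRepro.GenQLargeEightNumL
import Summits.Ventures.PercRepro.GenQLargeEightNumM

/-!
# PercRepro — THEOREM LARGE AT RANK `8` (night-4, gen 18)

`lbSumQ'_eight_nonneg`: `0 ≤ lbSumQ' 8 fCore t n` for `3 ≤ t ≤ 7`, `eightLargeBound t ≤ n ≤ 175` (`54 / 56 / 60 / 71 / 91`
at `t = 3 … 7`; the 548 lemmas of `GenQLargeEightNumA … M`); **`jq_nonneg_of_large_eight`**: on a rank-`8` set `G` of a Core
matroid with `f(4) ≤ 10` and `|G| ≤ 175`, the type-`t` balance `Jq M G 8 t` is `≥ 0` from `|G| ≥ eightLargeBound t`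
(coranks `d ≥ 46 / 48 / 52 / 63 / 83`) — THEOREM LARGE one rank up from the `(9, 7)` cell's `jq_nonneg_of_large_seven`, with
no certificate: `GenQLargeGenB.jq_nonneg_of_lbSumQ'` on the core chain `sizeChain_core`.
Imports `GenQLargeEightNumA … M`.
-/
namespace PercRepro.Night4

open Finset ThmH SixFour GenQ PerFlat Star NightThree

variable {α : Type} [DecidableEq α] {M : Matroid α} [M.Finite]

/-- **The numerics at rank `8`**: `0 ≤ lbSumQ' 8 fCore t n` for `3 ≤ t ≤ 7`, `eightLargeBound t ≤ n ≤ 175`. -/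
theorem lbSumQ'_eight_nonneg {t n : ℕ} (ht3 : 3 ≤ t) (ht : t ≤ 7) (hn : eightLargeBound t ≤ n) (h175 : n ≤ 175) :
    0 ≤ lbSumQ' 8 fCore t n := by
  unfold eightLargeBound at hn
  interval_cases t
  · norm_num at hn
    by_cases ha : n ≤ 94
    · exact lbSumQ'_eight_nonneg_3_a (by omega) ha
    · by_cases hb : n ≤ 135
      · exact lbSumQ'_eight_nonneg_3_b (by omega) hb
      · exact lbSumQ'_eight_nonneg_3_c (by omega) h175
  · norm_num at hn
    by_cases hd : n ≤ 95
    · exact lbSumQ'_eight_nonneg_4_d (by omega) hd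
    · by_cases he : n ≤ 135
      · exact lbSumQ'_eight_nonneg_4_e (by omega) he
      · exact lbSumQ'_eight_nonneg_4_f (by omega) h175
  · norm_num at hn
    by_cases hg : n ≤ 98
    · exact lbSumQ'_eight_nonneg_5_g (by omega) hg
    · by_cases hh : n ≤ 137
      · exact lbSumQ'_eight_nonneg_5_h (by omega) hh
      · exact lbSumQ'_eight_nonneg_5_i (by omega) h175
  · norm_num at hn
    by_cases hj : n ≤ 123
    · exact lbSumQ'_eight_nonneg_6_j (by omega) hj
    · exact lbSumQ'_eight_nonneg_6_k (by omega) h175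
  · norm_num at hn
    by_cases hl : n ≤ 133
    · exact lbSumQ'_eight_nonneg_7_l (by omega) hl
    · exact lbSumQ'_eight_nonneg_7_m (by omega) h175

/-- **THEOREM LARGE AT RANK `8`**: on a rank-`8` set `G` of a Core matroid with `f(4) ≤ 10`, `|G| ≤ 175` and
`eightLargeBound t ≤ |G|` (`54 / 56 / 60 / 71 / 91` at `t = 3 … 7`), the type-`t` balance is `≥ 0` — no certificate. -/
theorem jq_nonneg_of_large_eight {p : ℕ} (hc : Core M p) (h10 : ∀ F ∈ flatsQ M 4, F.card ≤ 10) {G : Finset α}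
    (hG : G ⊆ gr M) (hrG : M.eRk (G : Set α) = ((8 : ℕ) : ℕ∞)) {t : ℕ} (ht3 : 3 ≤ t) (ht : t ≤ 7)
    (hn : eightLargeBound t ≤ G.card) (h175 : G.card ≤ 175) : 0 ≤ Jq M G 8 t :=
  jq_nonneg_of_lbSumQ' (simple_of_core hc) (sizeChain_core hc h10 8) (by norm_num) hG hrG (by omega)
    (lbSumQ'_eight_nonneg ht3 ht hn h175)

end PercRepro.Night4
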